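import Literature.Analysis.OperatorTheory.YangMillsMatrixModelAgmonDerivatives
import Literature.Analysis.OperatorTheory.YangMillsMatrixModelLocalSobolev
import Literature.Analysis.Calculus.MultilinearComponentBounds
import Mathlib.Algebra.Order.Chebyshev
import HarnessLib

/-!
# Pointwise exponential decay of eigenfunctions of Lüscher's matrix-model Hamiltonian and of their derivatives (`ExpDecay₂`)

Topic `Literature/Analysis/OperatorTheory`; LAST decay file (N5, pointwise step) of the formalisation of the named fact
`LuscherHamiltonianEigenfunctions` (AL1).  Inputs: `YangMillsMatrixModelAgmonDerivatives.lean` (`∫ e^{2a⟨x⟩}(∂_w f)² < ∞` for every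
coordinate word `w` and every `a`) and `YangMillsMatrixModelLocalSobolev.lean` (`μ(B₁)|h(0)| ≤ ∫_{B₁}|h| + K(∫‖D⁵h‖²)^{1/2}`, compactly
supported smooth `h` on `ℝ⁹`).

* `exists_abs_le_exp_neg_norm` — a smooth `g` all of whose coordinate derivatives of order `≤ 5` satisfy `e^{⟨x⟩}∂_w g ∈ L²` obeys
  `|g(x)| ≤ C e^{−‖x‖}`: apply the local Sobolev bound to `h = χ₁ · g(x₀ + ·)` (`χ₁` the tree's unit radial cut-off), expand `D⁵h` by the
  Leibniz bound (Mathlib `norm_iteratedFDeriv_mul_le`), control `‖D^j g‖` by its coordinate components (`multilinear_norm_le_sum_abs_apply`,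
  components = word derivatives, `iteratedFDeriv_apply_unitDir`), and extract the factor `e^{−2‖x₀‖}` from the weight on the ball `B(x₀, 2)`.
* ★ `expDecay₂_of_eigenfunction` — **for a smooth `L²` solution of `𝔥f = Ef` on `ℝ⁹`: `ExpDecay₂ f`**, i.e. `|f|, |∂_p f|, |∂_p∂_q f| ≤ C e^{−‖x‖}`
  (Agmon 1982 Cor. 4.5 / Thm. 5.1 with the interior estimates of Gilbarg–Trudinger Thm. 6.2, as cited in the AL1 docstring).

All proved; no definitions, no named facts.

## References
* [Agmon1982] S. Agmon, *Lectures on Exponential Decay…*, Princeton Math. Notes 29 (1982), Cor. 4.5, Thm. 5.1.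
* [Adams1975] R. A. Adams, *Sobolev Spaces* (1975), Thm 5.4.
-/

noncomputable section

open MeasureTheory Filter Topology Function Metric Module
open scoped BigOperators ContDiff ENNReal NNReal

namespace Literature.Analysis.OperatorTheory.YMMatrixModel

/-! ### 1. Components of iterated derivatives are word derivatives; norm bounds -/

section Components

variable {g : ZM → ℝ}

/-- Components of the iterated Fréchet derivative along coordinate directions are iterated partial derivatives:
`Dʲg(y)(e_{I₀}, …, e_{I_{j−1}}) = (∂_{I₀} ⋯ ∂_{I_{j−1}} g)(y)`. [cite: Adams1975, Thm 5.4] -/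
theorem iteratedFDeriv_apply_unitDir (hg : ContDiff ℝ ∞ g) :
    ∀ (j : ℕ) (I : Fin j → Fin 3 × Fin 3) (y : ZM),
      iteratedFDeriv ℝ j g y (fun k => unitDir (I k)) = ((List.ofFn I).foldr pderiv g) y := by
  intro j
  induction j with
  | zero => intro I y; simp [List.ofFn_zero]
  | succ j ih =>
    intro I y
    have hcons : (fun k : Fin (j + 1) => unitDir (I k)) = Fin.cons (unitDir (I 0)) (fun k => unitDir (Fin.tail I k)) := by
      funext k; refine Fin.cases ?_ (fun i => ?_) k <;> simp [Fin.tail]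
    rw [hcons, ← Literature.Analysis.Calculus.fderiv_iteratedFDeriv_apply_const (hg.contDiffAt.of_le (by exact_mod_cast le_top))]
    have hfun : (fun z => iteratedFDeriv ℝ j g z fun k => unitDir (Fin.tail I k)) = (List.ofFn (Fin.tail I)).foldr pderiv g :=
      funext fun z => ih (Fin.tail I) z
    rw [hfun, List.ofFn_succ]
    rfl

/-- **`‖Dʲg(y)‖² ≤ 9ʲ Σ_I (∂_{w_I} g(y))²`** (operator norm from coordinate components, then Cauchy–Schwarz). [cite: Adams1975, Thm 5.4] -/
theorem norm_iteratedFDeriv_sq_le (hg : ContDiff ℝ ∞ g) (j : ℕ) (y : ZM) :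
    ‖iteratedFDeriv ℝ j g y‖ ^ 2 ≤
      (Fintype.card (Fin j → Fin 3 × Fin 3) : ℝ) * ∑ I : Fin j → Fin 3 × Fin 3, ((List.ofFn I).foldr pderiv g) y ^ 2 := by
  have h1 := Literature.Analysis.Calculus.multilinear_norm_le_sum_abs_apply (EuclideanSpace.basisFun (Fin 3 × Fin 3) ℝ)
    (iteratedFDeriv ℝ j g y)
  have h2 : ∀ I : Fin j → Fin 3 × Fin 3, (fun k => (EuclideanSpace.basisFun (Fin 3 × Fin 3) ℝ) (I k)) = fun k => unitDir (I k) := by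
    intro I; funext k; rw [EuclideanSpace.basisFun_apply]; rfl
  simp only [h2, iteratedFDeriv_apply_unitDir hg] at h1
  have h3 := sq_sum_le_card_mul_sum_sq (s := (Finset.univ : Finset (Fin j → Fin 3 × Fin 3)))
    (f := fun I => |((List.ofFn I).foldr pderiv g) y|)
  simp only [Finset.card_univ, sq_abs] at h3
  calc ‖iteratedFDeriv ℝ j g y‖ ^ 2 ≤ (∑ I : Fin j → Fin 3 × Fin 3, |((List.ofFn I).foldr pderiv g) y|) ^ 2 :=
        pow_le_pow_left₀ (norm_nonneg _) h1 2
    _ ≤ _ := h3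

end Components

/-! ### 2. The pointwise bound from weighted `L²` bounds of the derivatives of order `≤ 5` -/

section Pointwise

variable {g : ZM → ℝ}

/-- Uniform bounds for the derivatives of order `≤ 5` of the unit radial cut-off. [cite: Agmon1982, Thm. 5.1] -/
theorem exists_iteratedFDeriv_radialCutoffOne_bound :
    ∃ M : ℝ, 0 ≤ M ∧ ∀ i : ℕ, i ≤ 5 → ∀ z : ZM, ‖iteratedFDeriv ℝ i radialCutoffOne z‖ ≤ M := by
  have hη : ContDiff ℝ ∞ radialCutoffOne := radialCutoffOne_contDiff
  have hb : ∀ i : ℕ, ∃ Mi : ℝ, ∀ z : ZM, ‖iteratedFDeriv ℝ i radialCutoffOne z‖ ≤ Mi := by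
    intro i
    have hc : Continuous (iteratedFDeriv ℝ i radialCutoffOne) := hη.continuous_iteratedFDeriv (by exact_mod_cast le_top)
    have hs : HasCompactSupport (iteratedFDeriv ℝ i radialCutoffOne) := radialCutoffOne_hasCompactSupport.iteratedFDeriv i
    obtain ⟨C, hC⟩ := hc.bounded_above_of_compact_support hs
    exact ⟨C, hC⟩
  choose Mi hMi using hb
  refine ⟨∑ i ∈ Finset.range 6, |Mi i|, Finset.sum_nonneg fun i _ => abs_nonneg _, fun i hi z => ?_⟩
  calc ‖iteratedFDeriv ℝ i radialCutoffOne z‖ ≤ |Mi i| := (hMi i z).trans (le_abs_self _)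
    _ ≤ ∑ i ∈ Finset.range 6, |Mi i| :=
        Finset.single_le_sum (f := fun i => |Mi i|) (fun i _ => abs_nonneg _) (Finset.mem_range.mpr (by omega))

/-- On the ball `‖z‖ < 2`: `1 ≤ e^{4 − 2‖x₀‖} · e^{2⟨x₀ + z⟩}` (the weight extracts the decay). [cite: Agmon1982, Cor. 4.5] -/
theorem one_le_exp_mul_weight {x₀ z : ZM} (hz : ‖z‖ < 2) :
    1 ≤ Real.exp (4 - 2 * ‖x₀‖) * Real.exp ((1 : ℝ) * Real.sqrt (1 + ‖x₀ + z‖ ^ 2)) ^ 2 := by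
  rw [← Real.exp_nat_mul, ← Real.exp_add]
  apply Real.one_le_exp_iff.mpr ?_ |>.trans (le_of_eq rfl)
  have h1 := norm_le_bracket (x₀ + z)
  have h2 : ‖x₀‖ ≤ ‖x₀ + z‖ + ‖z‖ := by
    have := norm_sub_le (x₀ + z) z; simpa using this
  push_cast
  nlinarith

set_option maxHeartbeats 800000 in
/-- ★ **Pointwise exponential decay from weighted `L²` bounds of the derivatives of order `≤ 5`.**  If `g` is smooth on `ℝ⁹` and
`e^{⟨x⟩} ∂_w g ∈ L²` for every coordinate word `w` of length `≤ 5`, then `|g(x)| ≤ C e^{−‖x‖}` for one constant `C` and all `x`.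
[cite: Agmon1982, Thm. 5.1] [cite: Adams1975, Thm 5.4] -/
theorem exists_abs_le_exp_neg_norm (hg : ContDiff ℝ ∞ g)
    (hW : ∀ w : List (Fin 3 × Fin 3), w.length ≤ 5 →
      Integrable fun x : ZM => Real.exp ((1 : ℝ) * Real.sqrt (1 + ‖x‖ ^ 2)) ^ 2 * (w.foldr pderiv g) x ^ 2) :
    ∃ C : ℝ, ∀ x : ZM, |g x| ≤ C * Real.exp (-‖x‖) := by
  obtain ⟨K, hK, hSob⟩ := sobolev_five_pointwise
  obtain ⟨M, hM0, hM⟩ := exists_iteratedFDeriv_radialCutoffOne_bound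
  -- the total weighted budget
  set W : List (Fin 3 × Fin 3) → ℝ := fun w =>
    ∫ x : ZM, Real.exp ((1 : ℝ) * Real.sqrt (1 + ‖x‖ ^ 2)) ^ 2 * (w.foldr pderiv g) x ^ 2 with hW_def
  have hWnn : ∀ w, 0 ≤ W w := fun w => integral_nonneg fun x => by positivity
  set Wtot : ℝ := ∑ j ∈ Finset.range 6, (Fintype.card (Fin j → Fin 3 × Fin 3) : ℝ) *
    ∑ I : Fin j → Fin 3 × Fin 3, W (List.ofFn I) with hWtot_def
  have hWtot0 : 0 ≤ Wtot := Finset.sum_nonneg fun j _ => mul_nonneg (by positivity) (Finset.sum_nonneg fun I _ => hWnn _)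
  -- constants: Leibniz/binomial factor `B = Σ_i C(5,i)`, and the measure of the unit ball
  set B : ℝ := ∑ i ∈ Finset.range 6, ((5 : ℕ).choose i : ℝ) with hB_def
  have hB0 : 0 ≤ B := Finset.sum_nonneg fun i _ => by positivity
  set A : ℝ := (M * B) ^ 2 * 6 with hA_def
  have hA0 : 0 ≤ A := by positivity
  set V : ℝ := (volume (ball (0 : ZM) 1)).toReal with hV_def
  have hVpos : 0 < volume (ball (0 : ZM) 1) := measure_ball_pos _ _ one_pos
  have hVtop : volume (ball (0 : ZM) 1) < ⊤ := measure_ball_lt_top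
  have hV0 : 0 < V := ENNReal.toReal_pos hVpos.ne' hVtop.ne
  -- the final constant
  set C : ℝ := (V / 2 + Real.exp 4 * W [] / 2 + K.toReal * (Real.exp 2 * Real.sqrt (A * Wtot))) / V with hC_def
  refine ⟨C, fun x₀ => ?_⟩
  -- the localised, translated function
  have hGs : ContDiff ℝ ∞ (fun z : ZM => g (x₀ + z)) := hg.comp (contDiff_const.add contDiff_id)
  set h : ZM → ℝ := fun z => radialCutoffOne z * g (x₀ + z) with hh_def
  have hη : ContDiff ℝ ∞ radialCutoffOne := radialCutoffOne_contDiff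
  have hhs : ContDiff ℝ ∞ h := hη.mul hGs
  have hhc : HasCompactSupport h := radialCutoffOne_hasCompactSupport.mul_right
  have hh0 : h 0 = g x₀ := by
    simp only [hh_def, add_zero, radialCutoffOne_eq_one (by simp : ‖(0 : ZM)‖ ≤ 1), one_mul]
  have hsob := hSob hhs hhc
  rw [hh0] at hsob
  -- (i) the `L¹` term: `|h| ≤ |G| ≤ ½(e^{−‖x₀‖} + e^{‖x₀‖} G²)` on `B₁`, and `∫_{B₁} e^{‖x₀‖}G² ≤ e^{‖x₀‖} e^{2−2‖x₀‖} W []`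
  have hW0 : Integrable fun x : ZM => Real.exp ((1 : ℝ) * Real.sqrt (1 + ‖x‖ ^ 2)) ^ 2 * g x ^ 2 := by
    simpa using hW [] (by simp)
  have hW0' : Integrable fun z : ZM => Real.exp ((1 : ℝ) * Real.sqrt (1 + ‖x₀ + z‖ ^ 2)) ^ 2 * g (x₀ + z) ^ 2 :=
    hW0.comp_add_left x₀
  have hL1 : ∫⁻ z in ball (0 : ZM) 1, ‖h z‖ₑ ≤
      ENNReal.ofReal (Real.exp (-‖x₀‖) * (V / 2 + Real.exp 4 * W [] / 2)) := by
    -- pointwise on the ball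
    have hpt : ∀ z ∈ ball (0 : ZM) 1, ‖h z‖ₑ ≤ ENNReal.ofReal ((1 / 2 : ℝ) * Real.exp (-‖x₀‖) +
        (1 / 2 : ℝ) * Real.exp (-‖x₀‖) * Real.exp 4 *
          (Real.exp ((1 : ℝ) * Real.sqrt (1 + ‖x₀ + z‖ ^ 2)) ^ 2 * g (x₀ + z) ^ 2)) := by
      intro z hz
      rw [mem_ball_zero_iff] at hz
      rw [← ofReal_norm]
      apply ENNReal.ofReal_le_ofReal
      have hηle : |radialCutoffOne z| ≤ 1 := by
        have := radialCutoffOne_mem_Icc z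
        rw [abs_le]; constructor <;> linarith [this.1, this.2]
      have hGabs : ‖h z‖ ≤ |g (x₀ + z)| := by
        rw [Real.norm_eq_abs, hh_def]
        simp only [abs_mul]
        calc |radialCutoffOne z| * |g (x₀ + z)| ≤ 1 * |g (x₀ + z)| := mul_le_mul_of_nonneg_right hηle (abs_nonneg _)
          _ = |g (x₀ + z)| := one_mul _
      -- `|G| ≤ ½(δ + G²/δ)`, `δ = e^{−‖x₀‖}`, and `1/δ · G² ≤ e^{−‖x₀‖} e² · weight · G²` on the ball of radius 1 ⊂ 2
      have hwt := one_le_exp_mul_weight (x₀ := x₀) (z := z) (by linarith)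
      have hδ : 0 < Real.exp (-‖x₀‖) := Real.exp_pos _
      have hprod : Real.exp (-‖x₀‖) * Real.exp ‖x₀‖ = 1 := by rw [← Real.exp_add]; simp
      have hsplit : Real.exp (4 - 2 * ‖x₀‖) = Real.exp (-‖x₀‖) * Real.exp (-‖x₀‖) * Real.exp 4 := by
        rw [← Real.exp_add, ← Real.exp_add]; ring_nf
      have hG2 : 0 ≤ g (x₀ + z) ^ 2 := sq_nonneg _
      have hw2 : 0 ≤ Real.exp ((1 : ℝ) * Real.sqrt (1 + ‖x₀ + z‖ ^ 2)) ^ 2 := sq_nonneg _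
      -- AM–GM: `|G| ≤ ½ δ + ½ G²/δ` with `1/δ = e^{‖x₀‖}`
      have hamgm : |g (x₀ + z)| ≤ (1 / 2 : ℝ) * Real.exp (-‖x₀‖) + (1 / 2 : ℝ) * Real.exp ‖x₀‖ * g (x₀ + z) ^ 2 := by
        have hε : 0 < Real.exp ‖x₀‖ := Real.exp_pos _
        set t : ℝ := |g (x₀ + z)| with ht
        have ht0 : 0 ≤ t := abs_nonneg _
        have key : 2 * (Real.exp ‖x₀‖ * t) ≤ 1 + (Real.exp ‖x₀‖ * t) ^ 2 := by nlinarith [sq_nonneg (Real.exp ‖x₀‖ * t - 1)]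
        have hgt : g (x₀ + z) ^ 2 = t ^ 2 := by rw [ht, sq_abs]
        rw [hgt]
        calc t = (Real.exp ‖x₀‖ * t) * Real.exp (-‖x₀‖) := by
              rw [mul_comm (Real.exp ‖x₀‖) t, mul_assoc, mul_comm (Real.exp ‖x₀‖), hprod, mul_one]
          _ ≤ ((1 + (Real.exp ‖x₀‖ * t) ^ 2) / 2) * Real.exp (-‖x₀‖) :=
              mul_le_mul_of_nonneg_right (by linarith) hδ.le
          _ = (1 / 2 : ℝ) * Real.exp (-‖x₀‖) + (1 / 2 : ℝ) * Real.exp ‖x₀‖ * t ^ 2 * (Real.exp (-‖x₀‖) * Real.exp ‖x₀‖) := by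
              ring
          _ = (1 / 2 : ℝ) * Real.exp (-‖x₀‖) + (1 / 2 : ℝ) * Real.exp ‖x₀‖ * t ^ 2 := by rw [hprod, mul_one]
      -- `e^{‖x₀‖} G² ≤ e^{−‖x₀‖} e⁴ (weight · G²)` from `1 ≤ e^{4−2‖x₀‖}·weight`
      have hkey : Real.exp ‖x₀‖ * g (x₀ + z) ^ 2 ≤
          Real.exp (-‖x₀‖) * Real.exp 4 * (Real.exp ((1 : ℝ) * Real.sqrt (1 + ‖x₀ + z‖ ^ 2)) ^ 2 * g (x₀ + z) ^ 2) := by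
        have h1 : Real.exp ‖x₀‖ * g (x₀ + z) ^ 2 ≤ Real.exp ‖x₀‖ * g (x₀ + z) ^ 2 *
            (Real.exp (4 - 2 * ‖x₀‖) * Real.exp ((1 : ℝ) * Real.sqrt (1 + ‖x₀ + z‖ ^ 2)) ^ 2) := by
          have := mul_le_mul_of_nonneg_left hwt (by positivity : 0 ≤ Real.exp ‖x₀‖ * g (x₀ + z) ^ 2)
          simpa using this
        have h2 : Real.exp ‖x₀‖ * g (x₀ + z) ^ 2 * (Real.exp (4 - 2 * ‖x₀‖) * Real.exp ((1 : ℝ) * Real.sqrt (1 + ‖x₀ + z‖ ^ 2)) ^ 2) =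
            Real.exp (-‖x₀‖) * Real.exp 4 * (Real.exp ((1 : ℝ) * Real.sqrt (1 + ‖x₀ + z‖ ^ 2)) ^ 2 * g (x₀ + z) ^ 2) *
              (Real.exp (-‖x₀‖) * Real.exp ‖x₀‖) := by
          rw [hsplit]; ring
        rw [h2, hprod, mul_one] at h1
        exact h1
      calc ‖h z‖ ≤ |g (x₀ + z)| := hGabs
        _ ≤ (1 / 2 : ℝ) * Real.exp (-‖x₀‖) + (1 / 2 : ℝ) * Real.exp ‖x₀‖ * g (x₀ + z) ^ 2 := hamgm
        _ ≤ _ := by nlinarith [hkey]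
    calc ∫⁻ z in ball (0 : ZM) 1, ‖h z‖ₑ
        ≤ ∫⁻ z in ball (0 : ZM) 1, ENNReal.ofReal ((1 / 2 : ℝ) * Real.exp (-‖x₀‖) +
            (1 / 2 : ℝ) * Real.exp (-‖x₀‖) * Real.exp 4 *
              (Real.exp ((1 : ℝ) * Real.sqrt (1 + ‖x₀ + z‖ ^ 2)) ^ 2 * g (x₀ + z) ^ 2)) :=
          setLIntegral_mono' measurableSet_ball hpt
      _ ≤ ∫⁻ z in ball (0 : ZM) 1, ENNReal.ofReal ((1 / 2 : ℝ) * Real.exp (-‖x₀‖)) +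
            ENNReal.ofReal ((1 / 2 : ℝ) * Real.exp (-‖x₀‖) * Real.exp 4 *
              (Real.exp ((1 : ℝ) * Real.sqrt (1 + ‖x₀ + z‖ ^ 2)) ^ 2 * g (x₀ + z) ^ 2)) :=
          lintegral_mono fun z => ENNReal.ofReal_add_le
      _ = ENNReal.ofReal ((1 / 2 : ℝ) * Real.exp (-‖x₀‖)) * volume (ball (0 : ZM) 1) +
            ∫⁻ z in ball (0 : ZM) 1, ENNReal.ofReal ((1 / 2 : ℝ) * Real.exp (-‖x₀‖) * Real.exp 4 *
              (Real.exp ((1 : ℝ) * Real.sqrt (1 + ‖x₀ + z‖ ^ 2)) ^ 2 * g (x₀ + z) ^ 2)) := by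
          rw [lintegral_add_left (measurable_const), setLIntegral_const, mul_comm]
      _ ≤ ENNReal.ofReal ((1 / 2 : ℝ) * Real.exp (-‖x₀‖)) * volume (ball (0 : ZM) 1) +
            ∫⁻ z, ENNReal.ofReal ((1 / 2 : ℝ) * Real.exp (-‖x₀‖) * Real.exp 4 *
              (Real.exp ((1 : ℝ) * Real.sqrt (1 + ‖x₀ + z‖ ^ 2)) ^ 2 * g (x₀ + z) ^ 2)) := by
          gcongr; exact Measure.restrict_le_self
      _ = ENNReal.ofReal ((1 / 2 : ℝ) * Real.exp (-‖x₀‖)) * volume (ball (0 : ZM) 1) +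
            ENNReal.ofReal ((1 / 2 : ℝ) * Real.exp (-‖x₀‖) * Real.exp 4 * W []) := by
          congr 1
          rw [← ofReal_integral_eq_lintegral_ofReal ((hW0'.const_mul _)) (ae_of_all _ fun z => by positivity),
            integral_const_mul]
          congr 2
          rw [hW_def]
          simp only [List.foldr_nil]
          exact integral_add_left_eq_self (μ := (volume : Measure ZM))
            (fun x => Real.exp ((1 : ℝ) * Real.sqrt (1 + ‖x‖ ^ 2)) ^ 2 * g x ^ 2) x₀
      _ = ENNReal.ofReal (Real.exp (-‖x₀‖) * (V / 2 + Real.exp 4 * W [] / 2)) := by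
          have hvol : volume (ball (0 : ZM) 1) = ENNReal.ofReal V := by rw [hV_def, ENNReal.ofReal_toReal hVtop.ne]
          rw [hvol, ← ENNReal.ofReal_mul (by positivity), ← ENNReal.ofReal_add (by positivity)
            (by have := hWnn []; positivity)]
          congr 1; ring
  -- (ii) the `D⁵` term: `‖D⁵h z‖² ≤ A e^{4−2‖x₀‖} Φ(z)` with `∫ Φ = Wtot`
  set Φ : ZM → ℝ := fun z => ∑ j ∈ Finset.range 6, (Fintype.card (Fin j → Fin 3 × Fin 3) : ℝ) *
    ∑ I : Fin j → Fin 3 × Fin 3, (Real.exp ((1 : ℝ) * Real.sqrt (1 + ‖x₀ + z‖ ^ 2)) ^ 2 *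
      ((List.ofFn I).foldr pderiv g) (x₀ + z) ^ 2) with hΦ_def
  have hΦ0 : ∀ z, 0 ≤ Φ z := fun z => Finset.sum_nonneg fun j _ =>
    mul_nonneg (by positivity) (Finset.sum_nonneg fun I _ => by positivity)
  have hIw : ∀ j ∈ Finset.range 6, ∀ I : Fin j → Fin 3 × Fin 3,
      Integrable fun z : ZM => Real.exp ((1 : ℝ) * Real.sqrt (1 + ‖x₀ + z‖ ^ 2)) ^ 2 *
        ((List.ofFn I).foldr pderiv g) (x₀ + z) ^ 2 := by
    intro j hj I
    have hlen : (List.ofFn I).length ≤ 5 := by rw [List.length_ofFn]; have := Finset.mem_range.mp hj; omega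
    exact (hW (List.ofFn I) hlen).comp_add_left x₀
  have hIj : ∀ j ∈ Finset.range 6, Integrable fun z : ZM => (Fintype.card (Fin j → Fin 3 × Fin 3) : ℝ) *
      ∑ I : Fin j → Fin 3 × Fin 3, (Real.exp ((1 : ℝ) * Real.sqrt (1 + ‖x₀ + z‖ ^ 2)) ^ 2 *
        ((List.ofFn I).foldr pderiv g) (x₀ + z) ^ 2) := fun j hj =>
    (integrable_finsetSum _ fun I _ => hIw j hj I).const_mul _
  have hΦint : Integrable Φ := integrable_finsetSum _ hIj
  have hΦtot : ∫ z, Φ z = Wtot := by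
    show ∫ z, (∑ j ∈ Finset.range 6, (Fintype.card (Fin j → Fin 3 × Fin 3) : ℝ) *
      ∑ I : Fin j → Fin 3 × Fin 3, (Real.exp ((1 : ℝ) * Real.sqrt (1 + ‖x₀ + z‖ ^ 2)) ^ 2 *
        ((List.ofFn I).foldr pderiv g) (x₀ + z) ^ 2)) = Wtot
    rw [integral_finsetSum _ hIj, hWtot_def]
    refine Finset.sum_congr rfl fun j hj => ?_
    rw [integral_const_mul, integral_finsetSum _ fun I _ => hIw j hj I]
    congr 1
    refine Finset.sum_congr rfl fun I _ => ?_
    exact integral_add_left_eq_self (μ := (volume : Measure ZM))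
      (fun x => Real.exp ((1 : ℝ) * Real.sqrt (1 + ‖x‖ ^ 2)) ^ 2 * ((List.ofFn I).foldr pderiv g) x ^ 2) x₀
  -- the Leibniz/component bound at a point of the ball
  have hleib : ∀ z, ‖z‖ < 2 → ‖iteratedFDeriv ℝ 5 h z‖ ^ 2 ≤ A * (Real.exp (4 - 2 * ‖x₀‖) * Φ z) := by
    intro z hz
    set S : ℝ := ∑ j ∈ Finset.range 6, (Fintype.card (Fin j → Fin 3 × Fin 3) : ℝ) *
      ∑ I : Fin j → Fin 3 × Fin 3, ((List.ofFn I).foldr pderiv g) (x₀ + z) ^ 2 with hS_def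
    have hS0 : 0 ≤ S := Finset.sum_nonneg fun j _ => mul_nonneg (by positivity) (Finset.sum_nonneg fun I _ => sq_nonneg _)
    have h1 := norm_iteratedFDeriv_mul_le (𝕜 := ℝ) (n := 5) hη hGs z (ENat.natCast_le_of_coe_top_le_withTop le_rfl 5)
    simp only [iteratedFDeriv_comp_add_left] at h1
    have h2 : ‖iteratedFDeriv ℝ 5 h z‖ ≤ M * ∑ i ∈ Finset.range 6, ((5 : ℕ).choose i : ℝ) * ‖iteratedFDeriv ℝ (5 - i) g (x₀ + z)‖ := by
      refine h1.trans ?_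
      rw [Finset.mul_sum]
      refine Finset.sum_le_sum fun i hi => ?_
      have hi' : i ≤ 5 := by have := Finset.mem_range.mp hi; omega
      have := hM i hi' z
      have h0 : 0 ≤ ((5 : ℕ).choose i : ℝ) * ‖iteratedFDeriv ℝ (5 - i) g (x₀ + z)‖ := by positivity
      calc ((5 : ℕ).choose i : ℝ) * ‖iteratedFDeriv ℝ i radialCutoffOne z‖ * ‖iteratedFDeriv ℝ (5 - i) g (x₀ + z)‖
          = ‖iteratedFDeriv ℝ i radialCutoffOne z‖ * (((5 : ℕ).choose i : ℝ) * ‖iteratedFDeriv ℝ (5 - i) g (x₀ + z)‖) := by ring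
        _ ≤ M * (((5 : ℕ).choose i : ℝ) * ‖iteratedFDeriv ℝ (5 - i) g (x₀ + z)‖) := mul_le_mul_of_nonneg_right this h0
    have h3 : ∀ i ∈ Finset.range 6, ‖iteratedFDeriv ℝ (5 - i) g (x₀ + z)‖ ^ 2 ≤ S := by
      intro i hi
      have hj : 5 - i ∈ Finset.range 6 := Finset.mem_range.mpr (by omega)
      have hcomp : ‖iteratedFDeriv ℝ (5 - i) g (x₀ + z)‖ ^ 2 ≤ (Fintype.card (Fin (5 - i) → Fin 3 × Fin 3) : ℝ) *
          ∑ I : Fin (5 - i) → Fin 3 × Fin 3, ((List.ofFn I).foldr pderiv g) (x₀ + z) ^ 2 := by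
        exact norm_iteratedFDeriv_sq_le hg (5 - i) (x₀ + z)
      refine hcomp.trans ?_
      rw [hS_def]
      have hterm : ∀ j ∈ Finset.range 6, (0 : ℝ) ≤ (fun j : ℕ => (Fintype.card (Fin j → Fin 3 × Fin 3) : ℝ) *
          ∑ I : Fin j → Fin 3 × Fin 3, ((List.ofFn I).foldr pderiv g) (x₀ + z) ^ 2) j := fun j _ =>
        mul_nonneg (Nat.cast_nonneg _) (Finset.sum_nonneg fun I _ => sq_nonneg _)
      exact Finset.single_le_sum hterm hj
    have h4 : ∑ i ∈ Finset.range 6, ((5 : ℕ).choose i : ℝ) * ‖iteratedFDeriv ℝ (5 - i) g (x₀ + z)‖ ≤ B * Real.sqrt S := by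
      rw [hB_def, Finset.sum_mul]
      refine Finset.sum_le_sum fun i hi => mul_le_mul_of_nonneg_left ?_ (by positivity)
      exact Real.le_sqrt_of_sq_le (h3 i hi)
    have h5 : ‖iteratedFDeriv ℝ 5 h z‖ ≤ M * B * Real.sqrt S := by
      calc ‖iteratedFDeriv ℝ 5 h z‖ ≤ M * ∑ i ∈ Finset.range 6, ((5 : ℕ).choose i : ℝ) * ‖iteratedFDeriv ℝ (5 - i) g (x₀ + z)‖ := h2
        _ ≤ M * (B * Real.sqrt S) := mul_le_mul_of_nonneg_left h4 hM0
        _ = M * B * Real.sqrt S := by ring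
    have h6 : ‖iteratedFDeriv ℝ 5 h z‖ ^ 2 ≤ (M * B) ^ 2 * S := by
      have := pow_le_pow_left₀ (norm_nonneg _) h5 2
      rw [mul_pow, Real.sq_sqrt hS0] at this
      exact this
    -- `S ≤ e^{4−2‖x₀‖} Φ z` termwise
    have hwt := one_le_exp_mul_weight (x₀ := x₀) (z := z) hz
    have h7 : S ≤ Real.exp (4 - 2 * ‖x₀‖) * Φ z := by
      rw [hS_def, hΦ_def, Finset.mul_sum]
      refine Finset.sum_le_sum fun j _ => ?_
      have hsum : ∑ I : Fin j → Fin 3 × Fin 3, ((List.ofFn I).foldr pderiv g) (x₀ + z) ^ 2 ≤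
          ∑ I : Fin j → Fin 3 × Fin 3, Real.exp (4 - 2 * ‖x₀‖) * (Real.exp ((1 : ℝ) * Real.sqrt (1 + ‖x₀ + z‖ ^ 2)) ^ 2 *
            ((List.ofFn I).foldr pderiv g) (x₀ + z) ^ 2) := by
        refine Finset.sum_le_sum fun I _ => ?_
        have h0 : 0 ≤ ((List.ofFn I).foldr pderiv g) (x₀ + z) ^ 2 := sq_nonneg _
        calc ((List.ofFn I).foldr pderiv g) (x₀ + z) ^ 2 = 1 * ((List.ofFn I).foldr pderiv g) (x₀ + z) ^ 2 := (one_mul _).symm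
          _ ≤ (Real.exp (4 - 2 * ‖x₀‖) * Real.exp ((1 : ℝ) * Real.sqrt (1 + ‖x₀ + z‖ ^ 2)) ^ 2) *
              ((List.ofFn I).foldr pderiv g) (x₀ + z) ^ 2 := mul_le_mul_of_nonneg_right hwt h0
          _ = Real.exp (4 - 2 * ‖x₀‖) * (Real.exp ((1 : ℝ) * Real.sqrt (1 + ‖x₀ + z‖ ^ 2)) ^ 2 *
              ((List.ofFn I).foldr pderiv g) (x₀ + z) ^ 2) := by ring
      calc (Fintype.card (Fin j → Fin 3 × Fin 3) : ℝ) * ∑ I : Fin j → Fin 3 × Fin 3, ((List.ofFn I).foldr pderiv g) (x₀ + z) ^ 2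
          ≤ (Fintype.card (Fin j → Fin 3 × Fin 3) : ℝ) * ∑ I : Fin j → Fin 3 × Fin 3, Real.exp (4 - 2 * ‖x₀‖) *
              (Real.exp ((1 : ℝ) * Real.sqrt (1 + ‖x₀ + z‖ ^ 2)) ^ 2 * ((List.ofFn I).foldr pderiv g) (x₀ + z) ^ 2) :=
            mul_le_mul_of_nonneg_left hsum (Nat.cast_nonneg _)
        _ = Real.exp (4 - 2 * ‖x₀‖) * ((Fintype.card (Fin j → Fin 3 × Fin 3) : ℝ) * ∑ I : Fin j → Fin 3 × Fin 3,
              (Real.exp ((1 : ℝ) * Real.sqrt (1 + ‖x₀ + z‖ ^ 2)) ^ 2 * ((List.ofFn I).foldr pderiv g) (x₀ + z) ^ 2)) := by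
            rw [← Finset.mul_sum]; ring
    rw [hA_def]
    nlinarith [h6, h7, hS0, sq_nonneg (M * B), mul_le_mul_of_nonneg_left h7 (sq_nonneg (M * B))]
  -- off the ball the fifth derivative vanishes
  have hzero : ∀ z, ¬ ‖z‖ < 2 → iteratedFDeriv ℝ 5 h z = 0 := by
    intro z hz
    have hopen : IsOpen {y : ZM | 2 < ‖y‖ ^ 2} := isOpen_lt continuous_const (continuous_norm.pow 2)
    have hzmem : z ∈ {y : ZM | 2 < ‖y‖ ^ 2} := by
      simp only [Set.mem_setOf_eq]; nlinarith [not_lt.mp hz, norm_nonneg z]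
    have hev : h =ᶠ[𝓝 z] fun _ => (0 : ℝ) := by
      filter_upwards [hopen.mem_nhds hzmem] with y hy
      simp only [hh_def, radialCutoffOne_eq_zero (le_of_lt hy), zero_mul]
    have := (hev.iteratedFDeriv (𝕜 := ℝ) 5).eq_of_nhds
    rw [this, iteratedFDeriv_fun_zero]
    rfl
  have hpt5 : ∀ z, ‖iteratedFDeriv ℝ 5 h z‖ₑ ^ (2 : ℝ) ≤ ENNReal.ofReal (A * Real.exp (4 - 2 * ‖x₀‖) * Φ z) := by
    intro z
    rw [← ofReal_norm, ENNReal.ofReal_rpow_of_nonneg (norm_nonneg _) (by norm_num)]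
    apply ENNReal.ofReal_le_ofReal
    rw [Real.rpow_two]
    by_cases hz : ‖z‖ < 2
    · have := hleib z hz; linarith [this]
    · rw [hzero z hz, norm_zero]
      have := hΦ0 z
      have : 0 ≤ A * Real.exp (4 - 2 * ‖x₀‖) * Φ z := by positivity
      simpa using this
  have hD5 : ∫⁻ z, ‖iteratedFDeriv ℝ 5 h z‖ₑ ^ (2 : ℝ) ≤ ENNReal.ofReal (A * Real.exp (4 - 2 * ‖x₀‖) * Wtot) := by
    calc ∫⁻ z, ‖iteratedFDeriv ℝ 5 h z‖ₑ ^ (2 : ℝ) ≤ ∫⁻ z, ENNReal.ofReal (A * Real.exp (4 - 2 * ‖x₀‖) * Φ z) :=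
          lintegral_mono hpt5
      _ = ENNReal.ofReal (∫ z, A * Real.exp (4 - 2 * ‖x₀‖) * Φ z) := by
          rw [ofReal_integral_eq_lintegral_ofReal (hΦint.const_mul _) (ae_of_all _ fun z => by have := hΦ0 z; positivity)]
      _ = ENNReal.ofReal (A * Real.exp (4 - 2 * ‖x₀‖) * Wtot) := by rw [integral_const_mul, hΦtot]
  -- (iii) assembly in `ℝ≥0∞`, then back to `ℝ`
  have hsqrt : (ENNReal.ofReal (A * Real.exp (4 - 2 * ‖x₀‖) * Wtot)) ^ ((1 : ℝ) / 2) =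
      ENNReal.ofReal (Real.exp (2 - ‖x₀‖) * Real.sqrt (A * Wtot)) := by
    rw [ENNReal.ofReal_rpow_of_nonneg (by positivity) (by norm_num), ← Real.sqrt_eq_rpow]
    congr 1
    have he : Real.exp (4 - 2 * ‖x₀‖) = Real.exp (2 - ‖x₀‖) ^ 2 := by rw [← Real.exp_nat_mul]; ring_nf
    rw [show A * Real.exp (4 - 2 * ‖x₀‖) * Wtot = Real.exp (2 - ‖x₀‖) ^ 2 * (A * Wtot) by rw [he]; ring,
      Real.sqrt_mul (sq_nonneg _) (A * Wtot), Real.sqrt_sq (Real.exp_pos _).le]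
  have hKfin : K = ENNReal.ofReal K.toReal := (ENNReal.ofReal_toReal hK.ne).symm
  have hR0 : 0 ≤ Real.exp (-‖x₀‖) * (V / 2 + Real.exp 4 * W [] / 2) := by have := hWnn []; positivity
  have hR1 : 0 ≤ K.toReal * (Real.exp (2 - ‖x₀‖) * Real.sqrt (A * Wtot)) := by positivity
  have htotal : volume (ball (0 : ZM) 1) * ‖g x₀‖ₑ ≤
      ENNReal.ofReal (Real.exp (-‖x₀‖) * (V / 2 + Real.exp 4 * W [] / 2) + K.toReal * (Real.exp (2 - ‖x₀‖) * Real.sqrt (A * Wtot))) := by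
    have h2nd : K * (∫⁻ z, ‖iteratedFDeriv ℝ 5 h z‖ₑ ^ (2 : ℝ)) ^ ((1 : ℝ) / 2) ≤
        ENNReal.ofReal (K.toReal * (Real.exp (2 - ‖x₀‖) * Real.sqrt (A * Wtot))) :=
      calc K * (∫⁻ z, ‖iteratedFDeriv ℝ 5 h z‖ₑ ^ (2 : ℝ)) ^ ((1 : ℝ) / 2)
          ≤ K * (ENNReal.ofReal (A * Real.exp (4 - 2 * ‖x₀‖) * Wtot)) ^ ((1 : ℝ) / 2) := by gcongr
        _ = ENNReal.ofReal (K.toReal * (Real.exp (2 - ‖x₀‖) * Real.sqrt (A * Wtot))) := by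
            rw [hsqrt, ENNReal.ofReal_mul ENNReal.toReal_nonneg, ← hKfin]
    refine hsob.trans ?_
    rw [ENNReal.ofReal_add hR0 hR1]
    exact add_le_add hL1 h2nd
  -- back to real numbers
  have hreal : V * |g x₀| ≤ Real.exp (-‖x₀‖) * (V / 2 + Real.exp 4 * W [] / 2) +
      K.toReal * (Real.exp (2 - ‖x₀‖) * Real.sqrt (A * Wtot)) := by
    have hne : volume (ball (0 : ZM) 1) * ‖g x₀‖ₑ ≠ ⊤ := ENNReal.mul_ne_top hVtop.ne enorm_ne_top
    have := ENNReal.toReal_mono ENNReal.ofReal_ne_top htotal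
    rw [ENNReal.toReal_mul, ENNReal.toReal_ofReal (add_nonneg hR0 hR1)] at this
    rw [hV_def]
    have he : (‖g x₀‖ₑ).toReal = |g x₀| := by rw [toReal_enorm, Real.norm_eq_abs]
    rw [he] at this
    exact this
  have hexp2 : Real.exp (2 - ‖x₀‖) = Real.exp 2 * Real.exp (-‖x₀‖) := by rw [← Real.exp_add]; ring_nf
  rw [hC_def]
  rw [div_mul_eq_mul_div, le_div_iff₀ hV0]
  rw [hexp2] at hreal
  nlinarith [hreal, Real.exp_pos (-‖x₀‖)]

end Pointwise

/-! ### 3. `ExpDecay₂` for eigenfunctions -/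

section Eigenfunction

variable {f : ZM → ℝ} {E : ℝ}

/-- Word derivatives of `∂_p f` are word derivatives of `f`: `∂_w (∂_p f) = ∂_{w ++ [p]} f`. [cite: Adams1975, Thm 5.4] -/
theorem foldr_pderiv_pderiv (w : List (Fin 3 × Fin 3)) (p : Fin 3 × Fin 3) (f : ZM → ℝ) :
    w.foldr pderiv (pderiv p f) = (w ++ [p]).foldr pderiv f := by
  rw [List.foldr_append]; rfl

/-- ★★ **`ExpDecay₂` for eigenfunctions of Lüscher's matrix-model Hamiltonian**: a smooth `f ∈ L²(ℝ⁹)` with `𝔥f = E f` pointwise satisfies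
`|f(x)|, |∂_p f(x)|, |∂_p∂_q f(x)| ≤ C e^{−‖x‖}`. [cite: Agmon1982, Cor. 4.5, Thm. 5.1] -/
theorem expDecay₂_of_eigenfunction (hf : ContDiff ℝ ∞ f) (hf2 : Integrable fun x => f x ^ 2)
    (heq : ∀ x, hApply f x = E * f x) : ExpDecay₂ f := by
  have hdec : ∀ (w : List (Fin 3 × Fin 3)),
      Integrable fun x : ZM => Real.exp ((1 : ℝ) * Real.sqrt (1 + ‖x‖ ^ 2)) ^ 2 * (w.foldr pderiv f) x ^ 2 :=
    fun w => integrable_exp_sq_mul_foldr_pderiv_sq hf hf2 heq w zero_le_one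
  -- `f` itself
  obtain ⟨C₀, hC₀⟩ := exists_abs_le_exp_neg_norm hf fun w _ => hdec w
  -- first derivatives
  have h1 : ∀ p : Fin 3 × Fin 3, ∃ C : ℝ, ∀ x : ZM, |pderiv p f x| ≤ C * Real.exp (-‖x‖) := fun p =>
    exists_abs_le_exp_neg_norm (contDiff_pderiv_of_infty hf p) fun w _ => by
      simpa only [foldr_pderiv_pderiv] using hdec (w ++ [p])
  choose C₁ hC₁ using h1
  -- second derivatives
  have h2 : ∀ p q : Fin 3 × Fin 3, ∃ C : ℝ, ∀ x : ZM, |pderiv p (pderiv q f) x| ≤ C * Real.exp (-‖x‖) := fun p q =>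
    exists_abs_le_exp_neg_norm (contDiff_pderiv_of_infty (contDiff_pderiv_of_infty hf q) p) fun w _ => by
      have e : w.foldr pderiv (pderiv p (pderiv q f)) = (w ++ [p] ++ [q]).foldr pderiv f := by
        rw [List.foldr_append, List.foldr_append]; rfl
      simpa only [e] using hdec (w ++ [p] ++ [q])
  choose C₂ hC₂ using h2
  -- one constant for all (each constant is nonnegative, being an upper bound of an absolute value at `x = 0` up to `e^0 = 1`)
  have hnn : ∀ {u : ZM → ℝ} {C : ℝ}, (∀ x, |u x| ≤ C * Real.exp (-‖x‖)) → 0 ≤ C := by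
    intro u C h
    have := h 0
    simp only [norm_zero, neg_zero, Real.exp_zero, mul_one] at this
    exact (abs_nonneg _).trans this
  refine ⟨C₀ + ∑ p, C₁ p + ∑ p, ∑ q, C₂ p q, fun x => ⟨?_, fun p => ?_, fun p q => ?_⟩⟩
  · have hs1 : 0 ≤ ∑ p, C₁ p := Finset.sum_nonneg fun p _ => hnn (hC₁ p)
    have hs2 : 0 ≤ ∑ p, ∑ q, C₂ p q := Finset.sum_nonneg fun p _ => Finset.sum_nonneg fun q _ => hnn (hC₂ p q)
    calc |f x| ≤ C₀ * Real.exp (-‖x‖) := hC₀ x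
      _ ≤ (C₀ + ∑ p, C₁ p + ∑ p, ∑ q, C₂ p q) * Real.exp (-‖x‖) := by
          apply mul_le_mul_of_nonneg_right _ (Real.exp_pos _).le; linarith
  · have hs0 : 0 ≤ C₀ := hnn hC₀
    have hs1 : C₁ p ≤ ∑ p, C₁ p := Finset.single_le_sum (f := C₁) (fun p _ => hnn (hC₁ p)) (Finset.mem_univ p)
    have hs2 : 0 ≤ ∑ p, ∑ q, C₂ p q := Finset.sum_nonneg fun p _ => Finset.sum_nonneg fun q _ => hnn (hC₂ p q)
    calc |pderiv p f x| ≤ C₁ p * Real.exp (-‖x‖) := hC₁ p x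
      _ ≤ (C₀ + ∑ p, C₁ p + ∑ p, ∑ q, C₂ p q) * Real.exp (-‖x‖) := by
          apply mul_le_mul_of_nonneg_right _ (Real.exp_pos _).le; linarith
  · have hs0 : 0 ≤ C₀ := hnn hC₀
    have hs1 : 0 ≤ ∑ p, C₁ p := Finset.sum_nonneg fun p _ => hnn (hC₁ p)
    have hs2 : C₂ p q ≤ ∑ p, ∑ q, C₂ p q := by
      have h1 : C₂ p q ≤ ∑ q, C₂ p q := Finset.single_le_sum (f := C₂ p) (fun q _ => hnn (hC₂ p q)) (Finset.mem_univ q)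
      have h2 : ∑ q, C₂ p q ≤ ∑ p, ∑ q, C₂ p q :=
        Finset.single_le_sum (f := fun p => ∑ q, C₂ p q) (fun p _ => Finset.sum_nonneg fun q _ => hnn (hC₂ p q))
          (Finset.mem_univ p)
      exact h1.trans h2
    calc |pderiv p (pderiv q f) x| ≤ C₂ p q * Real.exp (-‖x‖) := hC₂ p q x
      _ ≤ (C₀ + ∑ p, C₁ p + ∑ p, ∑ q, C₂ p q) * Real.exp (-‖x‖) := by
          apply mul_le_mul_of_nonneg_right _ (Real.exp_pos _).le; linarith

end Eigenfunction

end Literature.Analysis.OperatorTheory.YMMatrixModel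

end
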